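import Summits.Ventures.PercRepro.SixFourFrame
import Summits.Ventures.PercRepro.SixFourT1
import Summits.Ventures.PercRepro.SixFourT3
import Summits.Ventures.PercRepro.SixFourT4Final

/-!
# PercRepro — C-025 at `(6,4)`: the row statement, conditional on §22.6 and on the per-solid residue (p3, gen 9)

The `(6, 4)` frame (`SixFourFrame.lean`) reduces C-025 at `(6, 4)` on every finite matroid to the per-solid balance
`0 ≤ J M G (typeOf M G)` on the solids `G` of the simple core matroids.  This file records which types are in the
kernel and states the rest as an explicit hypothesis:

* `t ≤ 2` — every solid of every simple matroid (`J_zero_nonneg`, `J_one_nonneg`, `J_two_nonneg` of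
  `SixFourT1.lean`): `J_nonneg_of_typeOf_le_two`;
* `t = 3` — the cell «`g = 10`, planes `≤ 5`, lines `≤ 4`» (Proposition 21.9, `J_three_pos_of_cell10`); the other
  solids of type `3` (mine-2's Lemma 21.4 dichotomy and §21.5–21.7) are NOT in the kernel;
* `t = 4` — every solid with `g ≥ 10` points and plane traces `≤ 7`, conditional on `SixTwoSix` (Theorem 22,
  `J_four_nonneg_of_sixTwoSix`); the solids with `g ≤ 9` (mine-2's catalogue / engine run) or a plane trace of
  `≥ 8` points (the large-plane branch of §21.5–21.7) are NOT in the kernel.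

`SixFourResidue` is exactly the missing per-solid balance (type `3` outside the cell; type `4` with `g ≤ 9` or a
plane trace `≥ 8`), an ordinary `Prop`.  **`rls_six_four_of_sixTwoSix`**: `SixTwoSix → SixFourResidue →` C-025 at
`(6, 4)` on every finite matroid (`RLS M 6 4`, i.e. `(6/5) · #U(6, 4) ≤ #Y(6, 4)`); `c025_six_four_of_sixTwoSix` is
the same in the set-builder spelling of `C025`.  Nothing here is an axiom; discharging the two hypotheses turns the
conditional theorem into the row.
-/

namespace PercRepro.SixFour

open Finset ThmH PerFlat ThmN

variable {α : Type*} [DecidableEq α] {M : Matroid α} [M.Finite] {G : Finset α}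

/-- **The per-solid balance at the types `t ≤ 2`** holds for every solid of every simple matroid. -/
theorem J_nonneg_of_typeOf_le_two (hs : Simple M) (hG : G ∈ flatsQ M 4) (ht : typeOf M G ≤ 2) :
    0 ≤ J M G (typeOf M G) := by
  have hGg : G ⊆ gr M := (mem_flatsQ.1 hG).1
  have hr : M.eRk (G : Set α) = 4 := (mem_flatsQ.1 hG).2.2
  rcases (show typeOf M G = 0 ∨ typeOf M G = 1 ∨ typeOf M G = 2 by omega) with h | h | h <;> rw [h]
  · exact J_zero_nonneg hs hGg
  · exact J_one_nonneg hs hGg hr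
  · exact J_two_nonneg hs hGg hr

/-- A solid of a matroid of rank `≥ 6` has type `≤ 4` (`6 ≤ ρ(E) ≤ ρ(G) + ρ(E ∖ G) = 4 + ρ(E ∖ G)`). -/
theorem typeOf_le_four (hG : G ∈ flatsQ M 4) (hge : (6 : ℕ∞) ≤ M.eRank) : typeOf M G ≤ 4 := by
  have hGg : G ⊆ gr M := (mem_flatsQ.1 hG).1
  have hr : M.eRk (G : Set α) = 4 := (mem_flatsQ.1 hG).2.2
  unfold typeOf
  obtain ⟨r, hr', -⟩ := eRk_eq_nat M (gr M \ G)
  rw [hr', ENat.toNat_coe]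
  have hE : G ∪ (gr M \ G) = gr M := Finset.union_sdiff_of_subset hGg
  have h := M.eRk_union_le_eRk_add_eRk (G : Set α) ((gr M \ G : Finset α) : Set α)
  rw [← Finset.coe_union, hE, coe_gr, M.eRk_ground, hr, hr'] at h
  have h' := hge.trans h
  have h'' : ((6 : ℕ) : ℕ∞) ≤ ((4 + r : ℕ) : ℕ∞) := by
    push_cast
    exact h'
  have := (Nat.cast_le (α := ℕ∞)).1 h''
  omega

/-- **The per-solid residue of C-025 at `(6, 4)`** (an ordinary `Prop`): on every simple matroid of rank `≥ 6`
(coloop-free at rank `6`) and every solid `G`, the balance `0 ≤ J_t(G)` holds at type `t = 3` when `G` is not the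
cell «`g = 10`, planes `≤ 5`, lines `≤ 4`» of Proposition 21.9, and at type `t = 4` when `G` has at most `9` points
or a plane trace with at least `8` points — exactly the solids NOT covered by `SixFourT1` / `SixFourT3` /
Theorem 22 (mine-2's §21.4–21.7 and the `g ≤ 9` catalogue). -/
def SixFourResidue : Prop :=
  ∀ {β : Type} [DecidableEq β] (M : Matroid β) [M.Finite] (G : Finset β), Simple M → (6 : ℕ∞) ≤ M.eRank →
    (M.eRank = 6 → ∀ e, ¬ M.IsColoop e) → G ∈ flatsQ M 4 →
    (typeOf M G = 3 → ¬ Cell10 M G → 0 ≤ J M G 3) ∧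
    (typeOf M G = 4 → (G.card ≤ 9 ∨ ∃ P ∈ planes M, 8 ≤ (P ∩ G).card) → 0 ≤ J M G 4)

/-- **C-025 at `(6, 4)` on every finite matroid, conditional on §22.6 and on the per-solid residue**:
`SixTwoSix → SixFourResidue → RLS M 6 4`, i.e. `(6/5) · #{A ⊆ E : ρ(A) = 6, ρ(E ∖ A) = 4} ≤ #{A ⊆ E : ρ(A) = 5}`.
The frame `rls_six_four_of_perSolid` asks for `0 ≤ J M G (typeOf M G)` on every solid of every core matroid:
types `≤ 2` are `J_nonneg_of_typeOf_le_two`, type `3` is Proposition 21.9 on the cell and the residue elsewhere,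
type `4` is Theorem 22 (`J_four_nonneg_of_sixTwoSix`) for `g ≥ 10` with plane traces `≤ 7` and the residue
elsewhere; types `≥ 5` do not occur (`typeOf_le_four`). -/
theorem rls_six_four_of_sixTwoSix {α : Type} (h22 : SixTwoSix.{0}) (hres : SixFourResidue)
    (M : Matroid α) [M.Finite] : RLS M 6 4 := by
  classical
  apply rls_six_four_of_perSolid
  intro M _ hs hge hcol G hG
  have hGg : G ⊆ gr M := (mem_flatsQ.1 hG).1
  have hr : M.eRk (G : Set α) = 4 := (mem_flatsQ.1 hG).2.2
  have ht4 := typeOf_le_four hG hge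
  rcases (show typeOf M G ≤ 2 ∨ typeOf M G = 3 ∨ typeOf M G = 4 by omega) with h | h | h
  · exact J_nonneg_of_typeOf_le_two hs hG h
  · rw [h]
    by_cases hc : Cell10 M G
    · exact (J_three_pos_of_cell10 hs hc).le
    · exact (hres M G hs hge hcol hG).1 h hc
  · rw [h]
    by_cases hsmall : G.card ≤ 9 ∨ ∃ P ∈ planes M, 8 ≤ (P ∩ G).card
    · exact (hres M G hs hge hcol hG).2 h hsmall
    · push Not at hsmall
      exact J_four_nonneg_of_sixTwoSix h22 hs hGg hr
        (fun P hP => by have := hsmall.2 P hP; omega) (by omega)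

/-- **C-025 at `(6, 4)` in the set-builder spelling of `C025`**, conditional on `SixTwoSix` and `SixFourResidue`:
`Φ(6, 4) · #{A ⊆ E : ρ(A) = 6, ρ(E ∖ A) = 4} ≤ #{A ⊆ E : 4 < ρ(A) < 6}` on every finite matroid. -/
theorem c025_six_four_of_sixTwoSix {α : Type} (h22 : SixTwoSix.{0}) (hres : SixFourResidue)
    (M : Matroid α) [M.Finite] :
    phiK 6 4 * ({A : Set α | A ⊆ M.E ∧ M.eRk A = ((6 : ℕ) : ℕ∞) ∧ M.eRk (M.E \ A) = ((4 : ℕ) : ℕ∞)}.ncard : ℚ) ≤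
      ({A : Set α | A ⊆ M.E ∧ ((4 : ℕ) : ℕ∞) < M.eRk A ∧ M.eRk A < ((6 : ℕ) : ℕ∞)}.ncard : ℚ) := by
  have h := rls_six_four_of_sixTwoSix h22 hres M
  unfold ThmN.RLS at h
  exact h

end PercRepro.SixFour
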